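import Mathlib
import Summits.PneNP.PneNP.Theorems.OverlapGapAlgebraSolvableImpliesStableSectionUnitClauseDynamics

/-!
# PneNP / OverlapGapAlgebra — crux `SolvableImpliesStableSection` (stmt-PneNP-2463):
# the UNIT CLAUSE block (4/·) — muting: deferred decisions for the unit-clause dynamics

Support for crux `stmt-PneNP-2463` (`Summit.PneNP.PneNP.Theses.OverlapGapAlgebra.SolvableImpliesStableSection`),
registered stub `stub_lowDensity` (child G).  The principle behind the first-moment analysis of the
localized unit-clause dynamics (`…UnitClauseObjects`): a clause influences the dynamics only in the
round in which it is unit.  Hence (i) the dynamics with muted set `S` does not read the content of the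
clauses in `S` (`sissU_indep`: replacing the content of a muted clause changes nothing), and (ii) the
dynamics with muted sets `S ⊆ S'` agree as long as no clause of `S' \ S` has been unit
(`sissU_agree`); in particular a non-muted clause `i` that is unit at round `t` is unit at round `t`
of the dynamics in which `i` itself is muted, whose states do not depend on the content of `i`
(`sissU_agree_insert_of_unit`) — so, against those states, the content of `i` is a fresh uniform clause.

* `sissU_step_congr` — one round of the dynamics is determined by the states and the non-muted unit
  clauses;
* `sissU_indep`, `sissU_agree`, `sissU_agree_insert_of_unit`.
All objects are hypotheses; no definitions; axioms `propext`, `Classical.choice`, `Quot.sound`.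
-/

set_option linter.dupNamespace false -- `Summit.PneNP.PneNP.…`: summit = sub-problem (D-0017)

namespace Summit.PneNP.PneNP.Theorems

open Finset
open scoped Classical

section Mute

variable {m k n : ℕ} {R : ℕ}
  (st : Finset (Fin m) → ℕ → (Fin m → Fin k → Fin n × Bool) → Fin n → Option Bool)
  (dm : Finset (Fin m) → ℕ → (Fin m → Fin k → Fin n × Bool) → Fin n → Bool)
  (h0 : ∀ (S : Finset (Fin m)) (Φ : Fin m → Fin k → Fin n × Bool) (v : Fin n), st S 0 Φ v = none)
  (hstep : ∀ (S : Finset (Fin m)) (t : ℕ) (Φ : Fin m → Fin k → Fin n × Bool) (v : Fin n),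
    st S (t + 1) Φ v =
      if st S t Φ v = none then
        (if ∃ i : Fin m, i ∉ S ∧ ∃ j : Fin k, (Φ i j).1 = v ∧ ∀ j' : Fin k, j' ≠ j →
            st S t Φ (Φ i j').1 ≠ none ∧ st S t Φ (Φ i j').1 ≠ some (Φ i j').2
          then some (dm S t Φ v)
          else if (v : ℕ) * R / n = t then some true else none)
      else st S t Φ v)
  (hdm : ∀ (S : Finset (Fin m)) (t : ℕ) (Φ : Fin m → Fin k → Fin n × Bool) (v : Fin n) (i : Fin m)
    (j : Fin k), i ∉ S → (Φ i j).1 = v → st S t Φ v = none →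
    (∀ j' : Fin k, j' ≠ j → st S t Φ (Φ i j').1 ≠ none ∧ st S t Φ (Φ i j').1 ≠ some (Φ i j').2) →
    (∀ i' : Fin m, i' ∉ S → (∃ j₁ : Fin k, (Φ i' j₁).1 = v ∧ ∀ j' : Fin k, j' ≠ j₁ →
      st S t Φ (Φ i' j').1 ≠ none ∧ st S t Φ (Φ i' j').1 ≠ some (Φ i' j').2) → i ≤ i') →
    dm S t Φ v = (Φ i j).2)

include hstep hdm in
/-- **One round is determined by the states and the non-muted unit clauses.** If the states of
`(S, Φ)` and `(S', Φ')` agree at round `t`, and — when `v` is unset — every non-muted clause that is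
unit on `v` in one configuration is non-muted with the same content in the other, then the states of
`v` at round `t + 1` agree. -/
theorem sissU_step_congr (S S' : Finset (Fin m)) (t : ℕ) (Φ Φ' : Fin m → Fin k → Fin n × Bool)
    (v : Fin n) (hσ : ∀ w : Fin n, st S t Φ w = st S' t Φ' w)
    (hcl : st S t Φ v = none → ∀ i : Fin m, (i ∉ S ∧ ∃ j : Fin k, (Φ i j).1 = v ∧ ∀ j' : Fin k, j' ≠ j →
        st S t Φ (Φ i j').1 ≠ none ∧ st S t Φ (Φ i j').1 ≠ some (Φ i j').2) → i ∉ S' ∧ Φ' i = Φ i)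
    (hcl' : st S t Φ v = none → ∀ i : Fin m, (i ∉ S' ∧ ∃ j : Fin k, (Φ' i j).1 = v ∧ ∀ j' : Fin k,
        j' ≠ j → st S' t Φ' (Φ' i j').1 ≠ none ∧ st S' t Φ' (Φ' i j').1 ≠ some (Φ' i j').2) →
        i ∉ S ∧ Φ i = Φ' i) :
    st S (t + 1) Φ v = st S' (t + 1) Φ' v := by
  rw [hstep S t Φ v, hstep S' t Φ' v, ← hσ v]
  by_cases hv0 : st S t Φ v = none
  · rw [if_pos hv0, if_pos hv0]
    -- the unit predicates correspond
    have hunit_iff : ∀ i : Fin m, (i ∉ S ∧ ∃ j : Fin k, (Φ i j).1 = v ∧ ∀ j' : Fin k, j' ≠ j →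
          st S t Φ (Φ i j').1 ≠ none ∧ st S t Φ (Φ i j').1 ≠ some (Φ i j').2) ↔
        (i ∉ S' ∧ ∃ j : Fin k, (Φ' i j).1 = v ∧ ∀ j' : Fin k, j' ≠ j →
          st S' t Φ' (Φ' i j').1 ≠ none ∧ st S' t Φ' (Φ' i j').1 ≠ some (Φ' i j').2) := by
      intro i
      constructor
      · intro h
        obtain ⟨hiS', hi⟩ := hcl hv0 i h
        obtain ⟨-, j, hj, hrest⟩ := h
        refine ⟨hiS', j, by rw [hi]; exact hj, fun j' hj' => ?_⟩
        rw [hi, ← hσ]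
        exact hrest j' hj'
      · intro h
        obtain ⟨hiS, hi⟩ := hcl' hv0 i h
        obtain ⟨-, j, hj, hrest⟩ := h
        refine ⟨hiS, j, by rw [hi]; exact hj, fun j' hj' => ?_⟩
        rw [hi, hσ]
        exact hrest j' hj'
    have hex_iff := exists_congr hunit_iff
    by_cases hex : ∃ i : Fin m, i ∉ S ∧ ∃ j : Fin k, (Φ i j).1 = v ∧ ∀ j' : Fin k, j' ≠ j →
        st S t Φ (Φ i j').1 ≠ none ∧ st S t Φ (Φ i j').1 ≠ some (Φ i j').2
    · rw [if_pos hex, if_pos (hex_iff.1 hex)]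
      -- both demanded values are the sign of `v` in the least unit clause `i₀`
      have hTne : (univ.filter fun i : Fin m => i ∉ S ∧ ∃ j : Fin k, (Φ i j).1 = v ∧
          ∀ j' : Fin k, j' ≠ j → st S t Φ (Φ i j').1 ≠ none ∧ st S t Φ (Φ i j').1 ≠ some (Φ i j').2).Nonempty := by
        obtain ⟨i, hi⟩ := hex
        exact ⟨i, by simp only [mem_filter, mem_univ, true_and]; exact hi⟩
      obtain ⟨i₀, hi₀mem, hi₀le⟩ : ∃ i₀ : Fin m, (i₀ ∈ univ.filter fun i : Fin m => i ∉ S ∧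
          ∃ j : Fin k, (Φ i j).1 = v ∧ ∀ j' : Fin k, j' ≠ j → st S t Φ (Φ i j').1 ≠ none ∧
            st S t Φ (Φ i j').1 ≠ some (Φ i j').2) ∧
          ∀ i' ∈ (univ.filter fun i : Fin m => i ∉ S ∧ ∃ j : Fin k, (Φ i j).1 = v ∧
            ∀ j' : Fin k, j' ≠ j → st S t Φ (Φ i j').1 ≠ none ∧ st S t Φ (Φ i j').1 ≠ some (Φ i j').2),
            i₀ ≤ i' :=
        ⟨_, min'_mem _ hTne, fun i' hi' => min'_le _ i' hi'⟩
      simp only [mem_filter, mem_univ, true_and] at hi₀mem hi₀le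
      have hi₀all := hi₀mem
      obtain ⟨hi₀S, j₀, hj₀, hrest₀⟩ := hi₀mem
      have hleast : ∀ i' : Fin m, i' ∉ S → (∃ j₁ : Fin k, (Φ i' j₁).1 = v ∧ ∀ j' : Fin k, j' ≠ j₁ →
          st S t Φ (Φ i' j').1 ≠ none ∧ st S t Φ (Φ i' j').1 ≠ some (Φ i' j').2) → i₀ ≤ i' :=
        fun i' hi'S hi' => hi₀le i' ⟨hi'S, hi'⟩
      have hd : dm S t Φ v = (Φ i₀ j₀).2 := hdm S t Φ v i₀ j₀ hi₀S hj₀ hv0 hrest₀ hleast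
      obtain ⟨hi₀S', hi₀⟩ := hcl hv0 i₀ hi₀all
      have hd' : dm S' t Φ' v = (Φ' i₀ j₀).2 := by
        refine hdm S' t Φ' v i₀ j₀ hi₀S' (by rw [hi₀]; exact hj₀) (by rw [← hσ]; exact hv0)
          (fun j' hj' => by rw [hi₀, ← hσ]; exact hrest₀ j' hj') fun i' hi'S' hi' => ?_
        have h2 := (hunit_iff i').2 ⟨hi'S', hi'⟩
        exact hleast i' h2.1 h2.2
      rw [hd, hd', hi₀]
    · rw [if_neg hex, if_neg (fun h => hex (hex_iff.2 h))]
  · rw [if_neg hv0, if_neg hv0, hσ]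

include h0 hstep hdm in
/-- **Muted content is not read.** If `c ∈ S`, replacing the content of clause `c` does not change the
states of the dynamics with muted set `S`. -/
theorem sissU_indep (S : Finset (Fin m)) (c : Fin m) (hc : c ∈ S) (Φ : Fin m → Fin k → Fin n × Bool)
    (x : Fin k → Fin n × Bool) : ∀ (t : ℕ) (v : Fin n), st S t (Function.update Φ c x) v = st S t Φ v := by
  intro t
  induction t with
  | zero => intro v; rw [h0, h0]
  | succ t ih =>
    intro v
    refine sissU_step_congr st dm hstep hdm S S t (Function.update Φ c x) Φ v ih
      (fun _ i hi => ⟨hi.1, ?_⟩) (fun _ i hi => ⟨hi.1, ?_⟩)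
    · exact (Function.update_of_ne (fun h : i = c => hi.1 (by rw [h]; exact hc)) x Φ).symm
    · exact Function.update_of_ne (fun h : i = c => hi.1 (by rw [h]; exact hc)) x Φ

include h0 hstep hdm in
/-- **Agreement of nested mutings.** If `S ⊆ S'` and, before round `t`, no clause of `S' \ S` is unit
(in the dynamics with muted set `S`), then the dynamics with muted sets `S` and `S'` agree up to round
`t`. -/
theorem sissU_agree (S S' : Finset (Fin m)) (hSS' : S ⊆ S') (Φ : Fin m → Fin k → Fin n × Bool)
    (t : ℕ)
    (hno : ∀ t' : ℕ, t' < t → ∀ i : Fin m, i ∈ S' → i ∉ S → ∀ v : Fin n,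
      ¬ ∃ j : Fin k, (Φ i j).1 = v ∧ st S t' Φ v = none ∧ ∀ j' : Fin k, j' ≠ j →
        st S t' Φ (Φ i j').1 ≠ none ∧ st S t' Φ (Φ i j').1 ≠ some (Φ i j').2) :
    ∀ t' : ℕ, t' ≤ t → ∀ v : Fin n, st S t' Φ v = st S' t' Φ v := by
  intro t'
  induction t' with
  | zero => intro _ v; rw [h0, h0]
  | succ t' ih =>
    intro ht' v
    have ih' := ih (Nat.le_of_succ_le ht')
    refine sissU_step_congr st dm hstep hdm S S' t' Φ Φ v ih' (fun hv0 i hi => ⟨?_, rfl⟩)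
      (fun _ i hi => ⟨fun h => hi.1 (hSS' h), rfl⟩)
    intro hiS'
    obtain ⟨hiS, j, hj, hrest⟩ := hi
    exact hno t' (Nat.lt_of_succ_le ht') i hiS' hiS v ⟨j, hj, hv0, hrest⟩

end Mute

section Main

variable {m k n : ℕ} {R : ℕ}

/-- **A unit clause against its own muting.** If `i ∉ S` is unit on `v` at round `t` (muted set `S`),
then the dynamics with muted sets `S` and `insert i S` agree up to round `t` (a non-muted clause is
unit in at most one round, so `i` was not unit before `t`); in particular `i` is unit on `v` at round
`t` of the dynamics in which `i` is muted. -/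
theorem sissU_agree_insert_of_unit
    (st : Finset (Fin m) → ℕ → (Fin m → Fin k → Fin n × Bool) → Fin n → Option Bool)
    (dm : Finset (Fin m) → ℕ → (Fin m → Fin k → Fin n × Bool) → Fin n → Bool)
    (h0 : ∀ (S : Finset (Fin m)) (Φ : Fin m → Fin k → Fin n × Bool) (v : Fin n), st S 0 Φ v = none)
    (hstep : ∀ (S : Finset (Fin m)) (t : ℕ) (Φ : Fin m → Fin k → Fin n × Bool) (v : Fin n),
      st S (t + 1) Φ v =
        if st S t Φ v = none then
          (if ∃ i : Fin m, i ∉ S ∧ ∃ j : Fin k, (Φ i j).1 = v ∧ ∀ j' : Fin k, j' ≠ j →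
              st S t Φ (Φ i j').1 ≠ none ∧ st S t Φ (Φ i j').1 ≠ some (Φ i j').2
            then some (dm S t Φ v)
            else if (v : ℕ) * R / n = t then some true else none)
        else st S t Φ v)
    (hdm : ∀ (S : Finset (Fin m)) (t : ℕ) (Φ : Fin m → Fin k → Fin n × Bool) (v : Fin n) (i : Fin m)
      (j : Fin k), i ∉ S → (Φ i j).1 = v → st S t Φ v = none →
      (∀ j' : Fin k, j' ≠ j → st S t Φ (Φ i j').1 ≠ none ∧ st S t Φ (Φ i j').1 ≠ some (Φ i j').2) →
      (∀ i' : Fin m, i' ∉ S → (∃ j₁ : Fin k, (Φ i' j₁).1 = v ∧ ∀ j' : Fin k, j' ≠ j₁ →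
        st S t Φ (Φ i' j').1 ≠ none ∧ st S t Φ (Φ i' j').1 ≠ some (Φ i' j').2) → i ≤ i') →
      dm S t Φ v = (Φ i j).2)
    (S : Finset (Fin m)) (Φ : Fin m → Fin k → Fin n × Bool)
    (i : Fin m) (hi : i ∉ S) (t : ℕ) (v : Fin n)
    (hu : ∃ j : Fin k, (Φ i j).1 = v ∧ st S t Φ v = none ∧ ∀ j' : Fin k, j' ≠ j →
      st S t Φ (Φ i j').1 ≠ none ∧ st S t Φ (Φ i j').1 ≠ some (Φ i j').2) :
    ∀ t' : ℕ, t' ≤ t → ∀ w : Fin n, st S t' Φ w = st (insert i S) t' Φ w := by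
  refine sissU_agree st dm h0 hstep hdm S (insert i S) (subset_insert i S) Φ t ?_
  intro t' ht' i' hi'S' hi'S w hu'
  obtain rfl : i' = i := by
    rcases mem_insert.mp hi'S' with h | h
    · exact h
    · exact absurd h hi'S
  have := sissU_unit_round_unique st dm hstep S Φ i' hi t t' v w hu hu'
  omega

end Main


end Summit.PneNP.PneNP.Theorems
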